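import Mathlib
import HarnessLib
import HarnessLib.Audit
import Summits.KontsevichZagierPeriods.Statement

/-!
Route: OctahedralSymmetry

DORMANT since 2026-09-04T23:37:41Z (reconciler: no traction for 5 d (last activity item-evidence-added at 2026-08-30T22:49:32Z); parked, not closed — `ledger route dormant route-KontsevichZagierPeriods-OctahedralSymmetry --off` to react) — unstaffed, not closed; items shared with open routes are served there. `ledger route dormant <id> --off` reactivates.

# Route OctahedralSymmetry — level 4 inside the rules — Zhao's non-standard cyclotomic relations are
one octahedral change of variables; Deligne's bound 2^w is reached regularisation-free (w ≤ 5
computed)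

Card octahedral-nonstandard-cyclotomic-relations, SHARPENED by an exact rank computation run this
session (folder numerics/,
NOTES.md §COMPUTATION). Level-4 multiple polylogarithm values (MPVs) are iterated integrals on
ℙ¹∖{0,∞,±1,±i} along [0,1]; their real
and imaginary parts are ℤ-combinations of RATIONAL simplex representations over the five real
letters 1/t, 1/(1−t), 1/(1+t), 1/(1+t²),
t/(1+t²) — literal KZ data. X (LEVEL-FOUR RELATION SECTOR): every ℤ-linear relation among these
representations predicted by mixed Tate
motives over ℤ[i][1/2] (Deligne2010: d(w,4) = 2^w) lies in KZ.relations, because it is generated by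
five REGULARISATION-FREE families
each of which is a short move chain: finite double shuffle (shuffle = dissection; stuffle =
LevelFourStuffleInKZ), distribution t ↦ t²
(SimplexDilationMove, ONE change of variables), the weight-one seed log|1+i|² = log 2 (one 1-dim
CoV), products of lower-weight
relations with words (ideal property), and ONE extra-dihedral element of the octahedral group S₄ ⊋
D₄ of the six-punctured sphere —
Zhao's involution σ(t) = (1−t)/(1+t), which PRESERVES the path [0,1] and is therefore ONE change of
variables on the ordered simplex
(OctahedralInvolutionMove) followed by partial fractions. Computed fact (exact linear algebra mod
two primes, every relation numerically
validated): these families have corank exactly 4, 8, 16, 32 = 2^w in the space of real/imaginary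
parts of the 16, 80, 400, 2000 convergent
words of weights 2, 3, 4, 5, and Zhao's non-standard (3,4) relation (arXiv:0707.1459 Rem 10.1) lies
in their span — whereas finite standard
relations + lifts stop at corank 5, 12, 27, 59 and Zhao's full standard families WITH regularisation
stop at 9 and 21 (w = 3, 4). The quarter-disc
face of the 3-cycle ρ(z) = (i−z)/(i+z) (the card's prism-Stokes compile) is an ALTERNATIVE generator
with the same ranks. Typed
deliverable: X₀ = ZhaoRelationInKZ ∧ LevelFourStuffleInKZ ∧ OctahedralInvolutionMove.
Lean: `ZhaoRelationInKZ ∧ LevelFourStuffleInKZ ∧ OctahedralInvolutionMove`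

## Assembly
Two stages, as in FurushoPentagon. MECHANISM (the sector, computed through weight 5):
OctahedralInvolutionMove + SimplexDilationMove
+ seed + shuffle-dissection + LevelFourStuffleInKZ (+ its (1)×(1,1) and (2)×(2) blocks, layer 2) +
lifts + IntegerDivision ⟹ each of
the 28, 152, 784, 3968 independent real relations of weights 2, 3, 4, 5 (all relations, granted
d(w,4) = 2^w) is a move chain, ZhaoRelationInKZ
among them (certificate in numerics/). TYPED (the deciding theorem `closes`, rev 9, route-choice
2026-08-16; Assembly re-threaded with it): ZhaoRelationInKZ → LevelFourStuffleInKZ →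
OctahedralInvolutionMove → KernelForm → KontsevichZagierPeriods, where KernelForm (∀ c, KZ.eval c =
0 → c ∈ KZ.relations: Conjecture 1 in kernel
form written out over KZCalculus, no conjecture constant named — the SHARED item
stmt-KontsevichZagierPeriods-10447, also carried by route
VietaFibre) is the DECLARED OPEN COMPLEMENT: named, not claimed, not attacked from this route. It
replaces the bespoke enlarged-kernel item
LevelFourSectorKernel (stmt-9845, revs 3–8: kernel ≤ relations ⊔ closure(the three relator
families)), which the tree theorem
Theorems/OctahedralSymmetryLevelFourSectorKernelStrength.lean (iff_summit_of) showed to be the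
summit modulo the three sector cruxes and which
is a corollary of KernelForm (le_sup_left): the complement of a sector route is now deduplicated
across routes instead of being re-derived —
and re-staffed — per route.

Rationale: WHY THIS LINE. Zhao (arXiv:0810.1064 §4, arXiv:0707.1459 Rem 6.3/10.1) found that Racinet's standard
relations (regularised double shuffle,
regularised distribution, weight-one seeds, lifts) leave corank 9 and 21 at (w,N) = (3,4), (4,4)
against the Deligne–Goncharov
bound 8, 16, and derived the missing relations from the OCTAHEDRAL symmetry of ℙ¹∖{0,∞,μ₄} through a
regularised loop around the
face {0,1,i}; Au (arXiv:2201.01676 §5) generalised path-homotopy + Möbius/unital pull-backs into a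
relation generator for levels
6, 8, 10, 12. Pointed at KZ's rules this becomes elementary real semialgebraic geometry: a Möbius
map with ℚ(i)-coefficients acts
ℤ-linearly on the five real letters, so a PATH-PRESERVING symmetry is literally rule 2) + rule 1b),
and the session's computation
shows that this single move, added to the finite (convergent, series-free except for the stuffle)
standard families, already
saturates Deligne's dimension through weight 5 — no tangential base point, no regularisation, no
2-cell. Imported: cyclotomic
motivic theory (Deligne2010, DeligneGoncharov2005, Racinet2002) for the target dimension; Zhao/Au
for the symmetry; the level-1
engines of routes FurushoPentagon (stuffle in KZ) and HurwitzMicroSectors (dilation = distribution)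
one storey up. What it does that
no prior route does: the first cyclotomic sector of Conjecture 1 beyond weight-2 boxes, with every
motivic relation assigned a named
move and an explicit certificate, and a precise negative-side residue (regularised families are NOT
needed at level 4 through
weight 5; level 9 weight 3 has no known geometric source at all, Au2022 §5.1). Negatives index:
empty at filing.

RANKED CRUXES. #2 ZhaoRelationInKZ (crux) — Zhao's non-standard weight-3 level-4 relation
5Li_{1,2}(−1,−i) = 46Li_{1,1,1}(i,1,1) − 7Li_{1,1,1}(−1,−1,i) − 13Li_{1,1,1}(i,i,i) +
13Li_{1,2}(−i,i) − Li_{1,1,1}(−i,−1,1) + 25Li_{1,1,1}(−i,1,1) − 8Li_{1,1,1}(i,i,−1) +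
18Li_{2,1}(−i,1) (arXiv:0707.1459 Rem 10.1), written through Li_s(x) = (−1)^ℓ
I(0^{s₁−1}a₁⋯0^{s_ℓ−1}a_ℓ), a_j = (x₁⋯x_j)^{−1}, as Σ_k c_k I(W_k) = 0 with c =
(−5,−46,7,13,13,1,−25,8,18) on the words (−1,0,−i), (−i,−i,−i), (−1,1,−i), (−i,−1,i), (i,0,1),
(i,−i,−i), (i,i,i), (−i,−1,1), (0,i,i) (outer → inner on {1 > t₀ > t₁ > t₂ > 0}; verified to 2e−9):
the REAL-PART and the IMAGINARY-PART ℤ-combinations of the nine 3-dimensional rational simplex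
representations (letter tables re/im, index m ↦ pole i^m, index 4 ↦ letter 0) lie in KZ.relations.
Card item K1; by the computed certificate it is a ℚ-combination of σ-, dilation-, seed-, lift- and
finite-double-shuffle relations (numerics/level4span.py). [deps: LevelFourStuffleInKZ,
OctahedralInvolutionMove, SimplexDilationMove, IntegerDivision] [difficulty: XL] (why it might fail:
the certificate uses lifts of weight-2 STUFFLES and the (1)×(1,1) stuffle block, whose move chains
need cubical partial fractions with Gaussian coefficients and convergent pieces (not yet done even
at level 1: Grothendieck 0275), plus IntegerDivision for the ℚ-coefficients.) [arXiv:0707.1459,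
arXiv:0810.1064, Deligne2010, KontsevichZagier2001]
#3 LevelFourStuffleInKZ (crux) — the series-side (stuffle) half of finite double shuffle at level 4,
depth block (1)×(2): for x = i^{−a} ≠ 1 and y = i^{−b}, Li₁(x)Li₂(y) = Li_{1,2}(x,y) + Li_{2,1}(y,x)
+ Li₃(xy), i.e. I(a)·I(0,b) − I(a,0,ab) − I(0,b,ab) + I(0,0,ab) = 0, as KZ.relations membership of
the real and of the imaginary parts: the product representation on (0,1) × Δ₂ (value = product by
Fubini) minus/plus three simplex representations on Δ₃ (letter tables re/im : Fin 4 → ℝ → ℝ, pole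
i^m; c = a + b in Fin 4). The finite-standard engine that the level-1 routes (FurushoPentagon
StuffleInKZ, Grothendieck 0275) need too, one storey up; 12 complex instances, all numerically
checked to ≤ 1.2e−7. [difficulty: L] (why it might fail: the stuffle is native to SERIES: inside the
rules it needs the cubical form Li₂(y) = ∬ y/(1−yuv) and a partial-fraction dissection with pieces
that stay absolutely integrable and ℚ-semialgebraic after splitting real/imaginary parts; no such
chain is written down at any level yet.) [Hoffman1997, IharaKanekoZagier2006, Racinet2002,
arXiv:0707.1459, KontsevichZagier2001]
#4 OctahedralInvolutionMove (crux) — Zhao's octahedral involution σ: e₀ ↔ e₁, e_i ↔ e_{−i}, e_{−1} ↔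
e_∞ (arXiv:0810.1064 §4) IS the self-map t ↦ (1−t)/(1+t) of [0,1]; on the open ordered simplex Δ_w
the map Φ(t)_j = (1 − t_{w−1−j})/(1 + t_{w−1−j}) is a ℚ-semialgebraic bijection with |det Φ′| = ∏_j
2/(1+t_j)², so for representations r, r′ on Δ_w with r.integrand t = r′.integrand(Φ t)·∏ 2/(1+t_j)²,
[r] − [r′] is ONE change-of-variables move. With partial fractions (σ^*ω_a = ω_{c_a} − ω_{−1}, c₀ =
1, c₁ = 0, c_i = −i, c_{−i} = i; σ^*ω_{−1} = −ω_{−1}) and path reversal it yields, for every word,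
I(σ^*W) = (−1)^w I(reverse W) — the family that closes the gap 12 → 8 (w = 3), 27 → 16 (w = 4), 59 →
32 (w = 5). Card mechanism (i), engine form. [difficulty: M] (why it might fail: only as typed:
r′.domain = Φ″Δ_w needs the image to be Δ_w exactly (order reversal via Fin.rev), the
within-derivative must be a CLM whose .det is ±∏ 2/(1+t_j)² (permutation sign absorbed by |·|), and
w = 0 is the degenerate point case.) [arXiv:0810.1064, KontsevichZagier2001, BCR1998]
#9 SimplexDilationMove (support) — distribution is one dilation (card P1;
HurwitzMicroSectors.DilationMove on the box, here on the simplex, m = 2): for r, r′ on Δ_w with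
r.integrand t = r′.integrand(t_j²)_j · ∏ 2t_j, [r] − [r′] ∈ changeOfVariablesRel (coordinatewise
squaring is an order-preserving bijection of Δ_w with Jacobian ∏ 2t_j > 0); with d(t²)/(t² − b) =
dt/(t−√b) + dt/(t+√b) it realises every level-2 → level-4 distribution relation. [difficulty:
provable-now] [arXiv:0707.1459, Racinet2002, KontsevichZagier2001]
#9 QuarterDiscFaceWeightTwo (support) — the smallest instance of the card's prism-Stokes compile
(face {0,1,i} of the octahedron, word (e₀, e_{−1}), imaginary part): [Δ₂, 1/(t₀(1+t₁²))] + [Δ₂,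
2t₁/((1+t₀²)(1+t₁²))] − [(0,1)², 2/((1+t₀²)(1+t₁))] ∈ KZ.relations — values G (Catalan, = ∫₀¹ arctan
t/t) + ((π/2)log 2 − G) − (π/2)log 2, checked to 4e−15. Geometric proof: the segment [0,i] and the
path [0,1]·arc(1→i) are homotopic in ℂ∖{−1,−i} rel endpoints; Stokes on Δ₂ × [0,1] for the closed
pulled-back 2-form has zero bulk, null degenerate faces (dz∧dz = 0) and rational primitives (the
components of the pull-back), then deconcatenation = domain additivity + Fubini and the letter
substitutions ρ^*ω_a = ω_{c_a} − ω_{−i}. Calibrates every convention of the route on a 3-term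
identity. [difficulty: M] [arXiv:0810.1064, arXiv:2201.01676, KontsevichZagier2001]
#9 IntegerDivision (support) — division by a positive integer is a derived rule (shared verbatim
with FurushoPentagon): n•c ∈ KZ.relations ⇒ c ∈ KZ.relations. Needed because the computed
certificates are ℚ-combinations of move relations. [difficulty: M] [KontsevichZagier2001]
#9 KernelForm (declared complement, conjecture-grade; SHARED item stmt-KontsevichZagierPeriods-10447
with route VietaFibre) — Conjecture 1 in kernel form ∀ c, KZ.eval c = 0 → c ∈ KZ.relations, verbatim
the definiens of KZKernelConjecture written out over KZCalculus (no conjecture constant is named, so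
the route's used-constants cone stays clean — D-0027 staffability). NAMED, NOT CLAIMED, NOT ATTACKED
from this route: it is the summit (kzKernelConjecture_iff_isRational) and the GPC-strength barriers
apply to it verbatim; it is filed only so that `closes` reaches the Statement honestly, and it is
staffed (if at all) ONCE, as the shared item, not per sector route. Inside the level-4 span its
content factorises as [OctahedralSpanAllWeights (crux rank 5; typed vocabulary now landed:
Literature CyclotomicSimplexRep + Theorems/OctahedralSymmetryOctahedralSpanAllWeightsDefs.lean): the
regularisation-free families reach corank 2^w for every w (computed for w ≤ 5)] + [Deligne2010:
d(w,4) = 2^w motivically] + [the period conjecture for MT(ℤ[i][1/2]) on level-4 MPVs — the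
transcendence input, open beyond weight 1] + [SimplexDilationMove, seeds, lifts (KZ.relations is an
ideal, KZProductIdeal), IntegerDivision]; outside it, the rest of Conjecture 1. HISTORY: revs 3–8
carried instead the bespoke ENLARGED KERNEL LevelFourSectorKernel (stmt-9845: ∀ c, eval c = 0 → c ∈
KZ.relations ⊔ closure(Zhao ∪ (1)×(2)-stuffle ∪ σ-involution relators)); the census theorem
Theorems/OctahedralSymmetryLevelFourSectorKernelStrength.lean (p98324) proved it summit-equivalent
modulo the three sector cruxes (of_summit, iff_summit_of), the auto-crux rule then seated two line
leads, five crux-ideators and two triagers on it with nothing honest to do, and the route-choice of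
2026-08-16 dropped it for the shared item (levelFourSectorKernel_of_kernelForm: nothing is lost; rev
6 had already dropped the by-name pair LevelFourSectorToKernel / KernelImpliesStatement). That
Strength file cites the rev-8 `closes` and the dropped decl and is OBSOLETE from rev 9
(operator/librarian: remove or archive it). [difficulty: open-problem] [KontsevichZagier2001,
HuberMullerStach2017, Deligne2010, DeligneGoncharov2005, arXiv:2201.01676]

TWO-LAYER PLAN. Foreseen glued splits (nothing filed now). ZhaoRelationInKZ ⇐
WeightThreeFamiliesInKZ (the 48 finite-double-shuffle, 12 dilation, 16
seed, 114 lift and 80 involution relations of weight 3, each ∈ KZ.relations — themselves instances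
of the three engines + shuffle
dissection) → ZhaoCertificate (the explicit ℚ-combination, a `decide`-level identity in the free
ℤ-module on 160 symbols, times
IntegerDivision) → ZhaoRelationInKZ. LevelFourStuffleInKZ ⇐ CubicalStuffleDissection (the box form
and its partial fractions with
convergent pieces, real coefficients: level 2 letters) → GaussianSplitting (the same with ±i poles
after real/imaginary splitting) →
LevelFourStuffleInKZ. OctahedralSpanAllWeights (informal crux) ⇐ a motivic proof: σ and the finite
families generate Racinet's
DMRD-type torsor at level 4 / Deligne's depth-one generators are σ-odd (Zhao: v + σ(v) = 0 for all
generators through degree 4).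

KILL CRITERIA. Every typed item is a TRUE identity between absolutely convergent rational integrals
(numerically certified), so a refutation of
ZhaoRelationInKZ, LevelFourStuffleInKZ or QuarterDiscFaceWeightTwo as KZ-memberships exhibits
equal-valued rational representations
that are not KZ-equivalent, i.e. ¬Conjecture 1 for the fixed calculus — close `refuted:<Decl>`, hand
the separating additive invariant
of FormalRep to route Neg, escalate to the operator. A refutation of OctahedralInvolutionMove /
SimplexDilationMove AS TYPED (image or
determinant side condition) forces a restate, not a pivot. What forces a PIVOT:
OctahedralSpanAllWeights failing at some weight w₀ ≥ 6
(exact rank < 2·#words − 2^{w₀}): then the quarter-disc faces (prism Stokes) and, failing those,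
Au's higher-degree unital chains or
regularised corners (route Deregularisation) re-enter as cruxes for w ≥ w₀ — the thesis degrades
from "one CoV" to "octahedral 2-cells".
Mooted if a coaction/dévissage route proves rules ≡ motives for MT(ℤ[i][1/2]) wholesale. KernelForm
refuted ⇒ the summit is false and every
positive route closes (route Neg's remit) — that is not a kill of THIS line's mechanism, whose items
stay true identities.

NOT DECOMPOSED YET. The weight-generic word vocabulary (definition request D1) and with it the typed
forms of OctahedralSpanAllWeights, of the generic
quarter-disc face family (36 e₁-free identities at weight 3, 144 at weight 4 — typed only at weight
2 here) and of the general
LevelFourStuffle (blocks (1)×(1,1), (2)×(2), …); the transcendence half (independence of Deligne's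
basis: contains Catalan's constant,
open) which stays inside the declared complement KernelForm — once OctahedralSpanAllWeights is typed
the tenure planner may file the
sector's honest LOCAL theorem as a support item (LevelFourSectorDecided: injectivity of the period
map on the formal level-4 module,
i.e. dim_ℚ = 2^w given Deligne2010, ∧ the three mechanism cruxes ∧ OctahedralSpanAllWeights ⇒ every
ℤ-combination of level-4 word
representations of value 0 lies in KZ.relations — provable from the items, the route's real
deliverable, deliberately not a hypothesis of `closes`); levels 6, 8, 10, 12 (Au2022: unital chains
of degree > 1 reach
Deligne's bound in low weight — CoV by NON-invertible rational maps + homotopy, a different sector)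
and the genuinely sourceless level 9
weight 3 (3 missing relations, no geometric generator known: Neg-facing informal item
LevelNineWitness); faces through ∞ (need the pole
at ∞, i.e. e_∞-corrected letters). All layer-2 or separate cards.

CHEAPEST FALSIFIER. RUN this session (numerics/level4span.py, pure python, 3 s for w ≤ 4, 18 min for
w = 5): exact rank mod 2147483647 (and 10⁹+7 for
w ≤ 4) of {conjugation, finite double shuffle, dilation, seed, lifts, involution} at w = 2, 3, 4, 5
→ coranks 4, 8, 16, 32 = 2^w (faces
instead of the involution: same for w ≤ 4; at w = 5 faces add nothing to the involution), Zhao's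
relation in the span at w = 3; every
relation of weight ≤ 3 validated numerically (worst residual 3e−7 = quadrature error), the
weight-generic generators being the same code. The refuter's first checks: (i) re-derive ONE
involution identity by hand, e.g. W = (−1,−1,−1): I(σ^*W) = −I(−1,−1,−1) with
σ^*ω_{−1} = −ω_{−1} gives −I = −I (trivial) — take W = (i, 0, −1) instead and compare numerically;
(ii) typecheck OctahedralInvolutionMove's
literal membership for w = 1 (Φ(t) = (1−t)/(1+t), |Φ′| = 2/(1+t)²) against changeOfVariablesRel;
(iii) weight 6 by kit (same
script, ~10⁴ words): corank must be 64 — the first weight beyond this session's data.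

NUMBERS. D(w,4) = 2^w (DeligneGoncharov2005; sharp motivically, Deligne2010). Convergent level-4
words of weight w: 4·5^{w−2}·4 = 16, 80, 400,
2000 (w = 2..5); real unknowns 2× that. Ranks (cumulative, this session): w=2: fds+dil+seed 27/32
(corank 5), +inv 28 (4); w=3:
fds 126, +dil 134, +seed 144, +lift 148 (corank 12), +inv 152 (8) [or +face 152]; w=4: fds 703, +dil
718, +seed 754, +lift 773
(corank 27), +inv 784 (16) [or +face 784]; w=5 (4000 unknowns): fds 3736, +dil 3767, +seed 3870,
+lift 3941 (corank 59), +inv 3968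
(corank 32 = 2^5), +face 3968. Zhao: standard (with regularisation) 9 at (3,4), 21 at (4,4)
(arXiv:0810.1064 §3).
Zhao's relation residual with the route's conventions: 1.8e−9 (complex), 1.9e−7 / 4.3e−7 (real/imag
tabulated form).
G = 0.9159655942, ∫_Δ 2t₁/((1+t₀²)(1+t₁²)) = 0.1728274510, (π/2)log 2 = 1.0887930452. Items at open:
9 typed (3 cruxes, 5 support,
1 assembly) + 3 informal after open (OctahedralSpanAllWeights crux rank 5, PathHomotopyStokes
support, LevelNineWitness support) = 12 ≤ 15;
after rev 9 (route-choice): 3 mechanism cruxes (9435 PROVED) + OctahedralSpanAllWeights + KernelForm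
(shared complement) + 3 proved supports
(SimplexDilationMove, QuarterDiscFaceWeightTwo, IntegerDivision) + 2 informal supports + Assembly =
11 ≤ 15.

DEFINITION REQUESTS. D1 (Literature/NumberTheory/Transcendental, `CyclotomicSimplexRep.lean`):
`KZ.levelFourWordRepRe/Im (W : List (Fin 5)) : IntegralRep W.length`
(domain openOrderedSimplex, integrand the real/imaginary part of ∏ 1/(t_j − i^{m_j}), letter 4 =
1/t), its convergence fact for words
with outer letter ≠ 1 and inner letter ≠ 0 (domination as in `KZ.mzvIntegrand_integrableOn_holds`),
the value fact (= Re/Im of the MPV),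
and the finite combinatorics `levelFourShuffle`, `levelFourStuffle`, `sigmaSubst`, `dilSubst` on
words — needed to type
OctahedralSpanAllWeights, the generic face family and the general LevelFourStuffle. Cite facts
wanted (family periods): Deligne2010 Thm
(N = 4: motivic Lie algebra free on one generator per degree, d(w,4) = 2^w); DeligneGoncharov2005
Thm 5.? (d(w,N) ≤ D(w,N)); Zhao2008 §4
(octahedral identity (equ:octa)).

Novelty: Searches (2026-08-15): grep of all 61 Theses/*.lean of the sub for octahedr|Zhao|cyclotom|level
4|roots of unity|μ_N (no route on level-4
MPV relations; BianchiHumbert uses the ideal octahedron for hyperbolic volume, HurwitzMicroSectors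
the level-4 weight-2 BOX sector only);
`ledger negatives --problem KontsevichZagierPeriods` (0 rows); `lit read arxiv:0707.1459` (Zhao2010,
pp. 1–3, 11, 12, 15, 16 read),
`lit read doi:10.1016/j.crma.2008.09.011` = arXiv:0810.1064 (Zhao2008, read in full: ρ, the loop
C_ε, identity (equ:octa), the involution
σ, Remark 1 on dihedral symmetry), `lit read arxiv:2201.01676` (Au2022 §3, §5 read: Möbius
pull-backs R^*ω(a) = ω(R⁻¹a) − ω(R⁻¹∞),
unital chains + homotopy as a non-standard-relation generator for N = 6, 8, 10, 12; "except for N =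
4 where octahedral symmetry is used
it is not clear how to find them"; level 9 weight 3 unreachable); `lit search "iterated integrals
multiple polylogarithm algebraic arguments
colored MZV level 4 Mobius"` (searchd unavailable, logged); `lit cite` for Deligne2010 / Zhao2008 /
Zhao2010 / Au2022; the card's own searches
(hub grep, lit hybrid, galaxy pdf, frontier) inherited.
Nearest prior art found: arXiv:0810.1064 (Zhao2008 §4: octahedral ORIGIN of the (3,4),(4,4)
non-standard relations via a REGULARISED loop and
the 3-cycle ρ) and arXiv:2201.01676 (Au2022 §5.1: path homotopy + unital pull-backs as a relation
generator at other levels); Deligne2010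
(the motivic dimension); hub routes FurushoPentagon / HurwitzMicroS  [refs: 10.1016/j.crma.2008.09.011`, 0707.1459, 0810.1064, 2201.01676, arxiv:0707.1459, doi:10.1016/j.crma.2008.09.011, arxiv:2201.01676, Au2022, Deligne2010]

Barriers (technique_class: automorphism-move, prism-stokes, finite-double-shuffle): - technique_class: automorphism-move, prism-stokes, finite-double-shuffle
- Literature.Barriers.KontsevichZagierPeriods.noSemialgebraicPrimitive_inv_sub_two: evaded — the
involution and the dilation are rule-2) moves with rational Jacobians, the stuffle chain is
dissection + partial fractions, and the only Newton–Leibniz instances (QuarterDiscFaceWeightTwo's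
prism) have primitives that are components of a pulled-back RATIONAL form (zero-bulk Stokes for a
closed form); no integrand is ever integrated out through log/arctan.
- Literature.Barriers.KontsevichZagierPeriods.kzConjecture_implies_oddZetaAlgIndep: respected, not
evaded: the route proves RELATIONS (spanning half); independence of Deligne's level-4 basis (which
contains ζ(3), π³, πG, G log 2, …) enters only as the named open hypothesis inside
LevelFourSectorToKernel.
- Literature.Barriers.KontsevichZagierPeriods.kzConjecture_implies_twoPiI_log_algIndep: engaged only
through that same hypothesis (log 2 and π/4 are the weight-1 values of the sector); no item claims
it.
- Literature.Barriers.KontsevichZagierPeriods.kzConjecture_implies_ellipticPeriods_algIndep: not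
engaged (mixed Tate over ℤ[i][1/2] only).
- Literature.Barriers.KontsevichZagierPeriods.cressonViuSos_prop_3_2: not applicable — no single
global semialgebraic map between two given representations is sought; the line is a presentation of
the relation module by many short chains (dissections included).
- Literature.Barriers.KontsevichZagierPeriods.not_complete_o

History (route lifecycle, newest last):
- 2026-08-15T16:37:51Z · rev 5: restated Assembly (stmt-KontsevichZagierPeriods-9439) — route-repair (cone, gen 2): re-thread Assembly 1:1 through the enlarged-kernel item LevelFourSectorKernel (stmt-9845) exactly as the deciding theorem closes doe (planner-rrepair-KontsevichZagierPeriods-Octahe-71d857a8-g2-0)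
- 2026-08-15T16:39:03Z · rev 6: dropped KernelImpliesStatement, LevelFourSectorToKernel — route-repair (cone, gen 2): drop the two non-load-bearing support items whose STATEMENTS name the conjecture leaf Literature.NumberTheory.Transcendental.KZKerne (planner-rrepair-KontsevichZagierPeriods-Octahe-71d857a8-g2-0)
- 2026-08-16T02:18:48Z · AUTO-CRUX: 2 conjecture-grade item(s) promoted to crux (OctahedralSpanAllWeights, LevelFourSectorKernel) — refuter vetting / tiering apply (operator:999:1362873)
- 2026-08-16T13:43:06Z · rev 9: restated Assembly (stmt-KontsevichZagierPeriods-11043 proved) — route-choice (unit rchoice-KontsevichZagierPeriods-Octahe-51f48a98, option RESTATE): de-crux stmt-9845 — LevelFourSectorKernel is Conjecture 1 in costume (Theor (planner-rchoice-KontsevichZagierPeriods-Octahe-51f48a98-0)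
- 2026-08-16T13:43:06Z · rev 9: dropped LevelFourSectorKernel — route-choice (unit rchoice-KontsevichZagierPeriods-Octahe-51f48a98, option RESTATE): de-crux stmt-9845 — LevelFourSectorKernel is Conjecture 1 in costume (Theor (planner-rchoice-KontsevichZagierPeriods-Octahe-51f48a98-0)
- 2026-08-23T20:09:20Z · DORMANT — reconciler: no traction for 6.2 d (last activity item-evidence-added at 2026-08-17T14:29:22Z); parked, not closed — `ledger route dormant route-KontsevichZagier (operator:999:4106411)
- 2026-08-30T22:35:32Z · REACTIVATED (open) — reconciler: reactivated — activity statement-checked at 2026-08-30T21:48:22Z after parking at 2026-08-23T20:09:20Z (operator:999:3904213)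
- 2026-09-04T23:37:41Z · DORMANT — reconciler: no traction for 5 d (last activity item-evidence-added at 2026-08-30T22:49:32Z); parked, not closed — `ledger route dormant route-KontsevichZagierPe (operator:999:3119924)

sub-problem: KontsevichZagierPeriods · status: dormant · opened planner-plancard-KontsevichZagierPeriods-Kont-24642a70-0 2026-08-15T13:57:20Z · rev 11 · ledger route-KontsevichZagierPeriods-OctahedralSymmetry
GENERATED by the gate from the ledger (D-0016/17). Provers cite these decls: `theorem foo : Summit.KontsevichZagierPeriods.KontsevichZagierPeriods.Theses.OctahedralSymmetry.<Decl> := …` in Summits/KontsevichZagierPeriods/KontsevichZagierPeriods/Theorems/<Name>.lean.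
-/

namespace Summit.KontsevichZagierPeriods.KontsevichZagierPeriods.Theses.OctahedralSymmetry

open scoped BigOperators Topology Manifold Classical MeasureTheory ProbabilityTheory Matrix InnerProductSpace ComplexConjugate ContinuousMap
open Filter Set Function TopologicalSpace MeasureTheory

attribute [summit_statement] _root_.KontsevichZagierPeriods

open Literature Periods

/-- item stmt-KontsevichZagierPeriods-9433 · crux · rank 2 · closed · proved by Summit.KontsevichZagierPeriods.OctahedralSymmetry.ZhaoRelationInKZ.ZhaoRelationInKZ_of @ f18ef7213c72 (prover) · by planner
why it might fail: the certificate uses lifts of weight-2 STUFFLES and the (1)×(1,1) stuffle block, whose move chains need cubical partial fractions with Gaussian coefficients and convergent pieces (not yet done even at level 1: Grothendieck 0275), plus IntegerDivision for the ℚ-coefficients.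
sources: arXiv:0707.1459, arXiv:0810.1064, Deligne2010, KontsevichZagier2001
[crux] Zhao's non-standard weight-3 level-4 relation 5Li_{1,2}(−1,−i) = 46Li_{1,1,1}(i,1,1) −
7Li_{1,1,1}(−1,−1,i) − 13Li_{1,1,1}(i,i,i) + 13Li_{1,2}(−i,i) − Li_{1,1,1}(−i,−1,1) +
25Li_{1,1,1}(−i,1,1) − 8Li_{1,1,1}(i,i,−1) + 18Li_{2,1}(−i,1) (arXiv:0707.1459 Rem 10.1), written
through Li_s(x) = (−1)^ℓ I(0^{s₁−1}a₁⋯0^{s_ℓ−1}a_ℓ), a_j = (x₁⋯x_j)^{−1}, as Σ_k c_k I(W_k) = 0 with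
c = (−5,−46,7,13,13,1,−25,8,18) on the words (−1,0,−i), (−i,−i,−i), (−1,1,−i), (−i,−1,i), (i,0,1),
(i,−i,−i), (i,i,i), (−i,−1,1), (0,i,i) (outer → inner on {1 > t₀ > t₁ > t₂ > 0}; verified to 2e−9):
the REAL-PART and the IMAGINARY-PART ℤ-combinations of the nine 3-dimensional rational simplex
representations (letter tables re/im, index m ↦ pole i^m, index 4 ↦ letter 0) lie in KZ.relations.
Card item K1; by the computed certificate it is a ℚ-combination of σ-, dilation-, seed-, lift- and
finite-double-shuffle relations (numerics/level4span.py). [deps: LevelFourStuffleInKZ,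
OctahedralInvolutionMove, SimplexDilationMove, IntegerDivision] [difficulty: XL] -/
@[route_item "route-KontsevichZagierPeriods-OctahedralSymmetry"]
def ZhaoRelationInKZ : Prop :=
  ∀ (re im : Fin 5 → ℝ → ℝ), re = ![fun t => 1 / (t - 1), fun t => t / (1 + t ^ 2), fun t => 1 / (1 + t), fun t => t / (1 + t ^ 2), fun t => 1 / t] → im = ![fun _ => 0, fun t => 1 / (1 + t ^ 2), fun _ => 0, fun t => -1 / (1 + t ^ 2), fun _ => 0] → ∀ (word : Fin 9 → Fin 3 → Fin 5) (coef : Fin 9 → ℤ), word = ![![2, 4, 3], ![3, 3, 3], ![2, 0, 3], ![3, 2, 1], ![1, 4, 0], ![1, 3, 3], ![1, 1, 1], ![3, 2, 0], ![4, 1, 1]] → coef = ![-5, -46, 7, 13, 13, 1, -25, 8, 18] → ∀ (R J : Fin 9 → Literature.NumberTheory.Transcendental.KZ.IntegralRep 3), (∀ k, (R k).domain = {t | 1 > t 0 ∧ t 0 > t 1 ∧ t 1 > t 2 ∧ t 2 > 0} ∧ (J k).domain = {t | 1 > t 0 ∧ t 0 > t 1 ∧ t 1 > t 2 ∧ t 2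 > 0}) → (∀ k, Set.EqOn (R k).integrand (fun t => re (word k 0) (t 0) * re (word k 1) (t 1) * re (word k 2) (t 2) - re (word k 0) (t 0) * im (word k 1) (t 1) * im (word k 2) (t 2) - im (word k 0) (t 0) * re (word k 1) (t 1) * im (word k 2) (t 2) - im (word k 0) (t 0) * im (word k 1) (t 1) * re (word k 2) (t 2)) (R k).domain) → (∀ k, Set.EqOn (J k).integrand (fun t => re (word k 0) (t 0) * re (word k 1) (t 1) * im (word k 2) (t 2) + re (word k 0) (t 0) * im (word k 1) (t 1) * re (word k 2) (t 2) + im (word k 0) (t 0) * re (word k 1) (t 1) * re (word k 2) (t 2) - im (word k 0) (t 0) * im (word k 1) (t 1) * im (word k 2) (t 2)) (J k).domain) → (∑ k, coef k • Literature.NumberTheory.Transcendental.KZ.of (R k)) ∈ Literature.NumberTheory.Transcendental.KZ.relations ∧ (∑ k, coef k • Literature.NumberTheory.Transcendental.KZ.of (J k)) ∈ Literature.NumberTheory.Transcendental.KZ.relations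

-- `ZhaoRelationInKZ` holds: proved by `Summit.KontsevichZagierPeriods.OctahedralSymmetry.ZhaoRelationInKZ.ZhaoRelationInKZ_of` @ f18ef7213c72 (its module imports this route file, so no `_holds` link can be stated here).

/-- item stmt-KontsevichZagierPeriods-9434 · crux · rank 3 · closed · proved by Summit.KontsevichZagierPeriods.OctahedralSymmetry.LevelFourStuffleInKZ.LevelFourStuffleInKZ_of @ f0ecd66444f7 (prover) · by planner
why it might fail: the stuffle is native to SERIES: inside the rules it needs the cubical form Li₂(y) = ∬ y/(1−yuv) and a partial-fraction dissection with pieces that stay absolutely integrable and ℚ-semialgebraic after splitting real/imaginary parts; no such chain is written down at any level yet.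
sources: Hoffman1997, IharaKanekoZagier2006, Racinet2002, arXiv:0707.1459, KontsevichZagier2001
[crux] the series-side (stuffle) half of finite double shuffle at level 4, depth block (1)×(2): for
x = i^{−a} ≠ 1 and y = i^{−b}, Li₁(x)Li₂(y) = Li_{1,2}(x,y) + Li_{2,1}(y,x) + Li₃(xy), i.e.
I(a)·I(0,b) − I(a,0,ab) − I(0,b,ab) + I(0,0,ab) = 0, as KZ.relations membership of the real and of
the imaginary parts: the product representation on (0,1) × Δ₂ (value = product by Fubini) minus/plus
three simplex representations on Δ₃ (letter tables re/im : Fin 4 → ℝ → ℝ, pole i^m; c = a + b in Fin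
4). The finite-standard engine that the level-1 routes (FurushoPentagon StuffleInKZ, Grothendieck
0275) need too, one storey up; 12 complex instances, all numerically checked to ≤ 1.2e−7.
[difficulty: L] -/
@[route_item "route-KontsevichZagierPeriods-OctahedralSymmetry"]
def LevelFourStuffleInKZ : Prop :=
  ∀ (re im : Fin 4 → ℝ → ℝ), re = ![fun t => 1 / (t - 1), fun t => t / (1 + t ^ 2), fun t => 1 / (1 + t), fun t => t / (1 + t ^ 2)] → im = ![fun _ => 0, fun t => 1 / (1 + t ^ 2), fun _ => 0, fun t => -1 / (1 + t ^ 2)] → ∀ (a b : Fin 4), a ≠ 0 → ∀ (P P' A A' B B' C C' : Literature.NumberTheory.Transcendental.KZ.IntegralRep 3), P.domain = {t | (0 < t 0 ∧ t 0 < 1) ∧ 1 > t 1 ∧ t 1 > t 2 ∧ t 2 > 0} → P'.domain = P.domain → Set.EqOn P.integrand (fun t => (re a (t 0) * re b (t 2) - im a (t 0) * im b (t 2)) / t 1) P.domain → Set.EqOn P'.integrand (fun t => (re a (t 0) * im b (t 2) + im a (t 0) * re b (t 2)) / t 1) P'.domain → A.domain = {t | 1 > t 0 ∧ t 0 > t 1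 ∧ t 1 > t 2 ∧ t 2 > 0} → A'.domain = A.domain → B.domain = A.domain → B'.domain = A.domain → C.domain = A.domain → C'.domain = A.domain → Set.EqOn A.integrand (fun t => (re a (t 0) * re (a + b) (t 2) - im a (t 0) * im (a + b) (t 2)) / t 1) A.domain → Set.EqOn A'.integrand (fun t => (re a (t 0) * im (a + b) (t 2) + im a (t 0) * re (a + b) (t 2)) / t 1) A'.domain → Set.EqOn B.integrand (fun t => (re b (t 1) * re (a + b) (t 2) - im b (t 1) * im (a + b) (t 2)) / t 0) B.domain → Set.EqOn B'.integrand (fun t => (re b (t 1) * im (a + b) (t 2) + im b (t 1) * re (a + b) (t 2)) / t 0) B'.domain → Set.EqOn C.integrand (fun t => re (a + b) (t 2) / (t 0 * t 1)) C.domain → Set.EqOn C'.integrand (fun t => im (a + b) (t 2) / (t 0 * t 1)) C'.domain → Literature.NumberTheory.Transcendental.KZ.of P - Literature.NumberTheory.Transcendental.KZ.of A - Literature.NumberTheory.Transcendental.KZ.of B + Literature.NumberTheory.Transcendental.KZ.of C ∈ Literature.NumberTheory.Transcendental.KZ.relations ∧ Literature.NumberTheory.Transcendental.KZ.of P' - Literature.NumberTheory.Transcendental.KZ.of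 A' - Literature.NumberTheory.Transcendental.KZ.of B' + Literature.NumberTheory.Transcendental.KZ.of C' ∈ Literature.NumberTheory.Transcendental.KZ.relations

-- `LevelFourStuffleInKZ` holds: proved by `Summit.KontsevichZagierPeriods.OctahedralSymmetry.LevelFourStuffleInKZ.LevelFourStuffleInKZ_of` @ f0ecd66444f7 (its module imports this route file, so no `_holds` link can be stated here).

/-- item stmt-KontsevichZagierPeriods-9435 · crux · rank 4 · closed · proved by Summit.KontsevichZagierPeriods.OctahedralSymmetry.OctahedralInvolutionMove.OctahedralInvolutionMove_of (prover) · by planner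
why it might fail: only as typed: r′.domain = Φ″Δ_w needs the image to be Δ_w exactly (order reversal via Fin.rev), the within-derivative must be a CLM whose .det is ±∏ 2/(1+t_j)² (permutation sign absorbed by |·|), and w = 0 is the degenerate point case.
sources: arXiv:0810.1064, KontsevichZagier2001, BCR1998
[crux] Zhao's octahedral involution σ: e₀ ↔ e₁, e_i ↔ e_{−i}, e_{−1} ↔ e_∞ (arXiv:0810.1064 §4) IS
the self-map t ↦ (1−t)/(1+t) of [0,1]; on the open ordered simplex Δ_w the map Φ(t)_j = (1 −
t_{w−1−j})/(1 + t_{w−1−j}) is a ℚ-semialgebraic bijection with |det Φ′| = ∏_j 2/(1+t_j)², so for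
representations r, r′ on Δ_w with r.integrand t = r′.integrand(Φ t)·∏ 2/(1+t_j)², [r] − [r′] is ONE
change-of-variables move. With partial fractions (σ^*ω_a = ω_{c_a} − ω_{−1}, c₀ = 1, c₁ = 0, c_i =
−i, c_{−i} = i; σ^*ω_{−1} = −ω_{−1}) and path reversal it yields, for every word, I(σ^*W) = (−1)^w
I(reverse W) — the family that closes the gap 12 → 8 (w = 3), 27 → 16 (w = 4), 59 → 32 (w = 5). Card
mechanism (i), engine form. [difficulty: M] -/
@[route_item "route-KontsevichZagierPeriods-OctahedralSymmetry"]
def OctahedralInvolutionMove : Prop :=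
  ∀ (w : ℕ) (r r' : Literature.NumberTheory.Transcendental.KZ.IntegralRep w), r.domain = {t | (∀ i, 0 < t i) ∧ (∀ i, t i < 1) ∧ StrictAnti t} → r'.domain = {t | (∀ i, 0 < t i) ∧ (∀ i, t i < 1) ∧ StrictAnti t} → (∀ t ∈ r.domain, r.integrand t = r'.integrand (fun j => (1 - t (Fin.rev j)) / (1 + t (Fin.rev j))) * ∏ j, 2 / (1 + t j) ^ 2) → Literature.NumberTheory.Transcendental.KZ.of r - Literature.NumberTheory.Transcendental.KZ.of r' ∈ Literature.NumberTheory.Transcendental.KZ.changeOfVariablesRel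

-- `OctahedralInvolutionMove` holds: proved by `Summit.KontsevichZagierPeriods.OctahedralSymmetry.OctahedralInvolutionMove.OctahedralInvolutionMove_of` (its module imports this route file, so no `_holds` link can be stated here).

-- item stmt-KontsevichZagierPeriods-9659 · crux (kind.auto-crux: conjecture-grade) · rank 5 · open · by planner — informal only, no Lean statement yet:
--   [crux] OctahedralSpanAllWeights (card K3 LevelFourSpan, weight-generic; the CONJECTURE raised by
--   this route's computation). For every weight w ≥ 2, in the free ℤ-module on the symbols Re I(W), Im
--   I(W) (W over the 4·5^{w−2}·4 convergent level-4 words: outer letter ≠ 1, inner letter ≠ 0), the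
--   ℚ-span of the six regularisation-free relation families — (conj) Re I(W̄) = Re I(W), Im I(W̄) = −Im
--   I(W); (fds) finite double shuffle: stuffle expansion minus shuffle expansion of every product of two
--   convergent MPVs of total weight w; (dil) distribution t ↦ t² on level-2 words (letters 0 ↦ 2·0, 1 ↦
--   (1)+(−1

/-- item stmt-KontsevichZagierPeriods-10447 · crux · rank 9 · open · by planner
why it might fail: It IS Conjecture 1 (kernel form ⇔ summit, kzKernelConjecture_iff_isRational): false iff one ℤ-combination of value 0 — e.g. with an elliptic, Γ or log member needing a non-semialgebraic Stokes primitive — has no move chain; GPC-strength barriers (odd zeta, 2πi/log, elliptic) apply verbatim.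
sources: KontsevichZagier2001, HuberMullerStach2017, CressonViusos2022
[target] the kernel form of Conjecture 1, stated INLINE over the calculus (verbatim the definiens of
`Literature.NumberTheory.Transcendental.KZKernelConjecture`, so the conjecture is this route's own
registered obligation rather than a by-name Literature leaf): every formal ℤ-combination c of KZ
integral representations with KZ.eval c = 0 lies in KZ.relations. ⇔ the summit
(kzKernelConjecture_iff_isRational in KZKernelConjectureForms; the implication used by `closes` is
the 3-line kernel step r.value = r'.value ⇒ eval([r] − [r']) = 0 ⇒ [r] − [r'] ∈ relations, formerly
the shared Assembly item stmt-KontsevichZagierPeriods-0197, now proved inside `closes`). Every other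
item of this route is an instance (value-zero representation, or pair with equal values) of it.
[difficulty: open-problem] -/
@[route_item "route-KontsevichZagierPeriods-OctahedralSymmetry"]
def KernelForm : Prop :=
  ∀ c : Literature.NumberTheory.Transcendental.KZ.FormalRep, Literature.NumberTheory.Transcendental.KZ.eval c = 0 → c ∈ Literature.NumberTheory.Transcendental.KZ.relations

/-- item stmt-KontsevichZagierPeriods-3934 · support · rank 9 · closed · proved by Summit.KontsevichZagierPeriods.FurushoPentagon.integerDivision_proof (prover) · by planner
sources: KontsevichZagier2001
[support] division by a positive integer is a DERIVED rule although "no division by integers is a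
rule" (Statement.lean): n•c ∈ KZ.relations ⇒ c ∈ KZ.relations. Proof sketch: S_n[σ,f] := [σ, f/n]
maps each of the four move families to itself, so S_n(relations) ⊆ relations; and c − n•S_n c ∈
relations by iterated integrand additivity; hence c = (c − n S_n c) + S_n(n c) ∈ relations. Needed
to pull Furusho's conclusions back from P_ℚ to P. [difficulty: M] -/
@[route_item "route-KontsevichZagierPeriods-OctahedralSymmetry"]
def IntegerDivision : Prop :=
  ∀ (c : Literature.NumberTheory.Transcendental.KZ.FormalRep) (n : ℕ), 0 < n → n • c ∈ Literature.NumberTheory.Transcendental.KZ.relations → c ∈ Literature.NumberTheory.Transcendental.KZ.relations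

-- `IntegerDivision` holds: proved by `Summit.KontsevichZagierPeriods.FurushoPentagon.integerDivision_proof` (its module imports this route file, so no `_holds` link can be stated here).

/-- item stmt-KontsevichZagierPeriods-9436 · support · rank 9 · closed · proved by Summit.KontsevichZagierPeriods.OctahedralSymmetry.SimplexDilationMove.simplexDilationMove_proof @ eac1817e3e66 (prover) · by planner
sources: arXiv:0707.1459, Racinet2002, KontsevichZagier2001
[support] distribution is one dilation (card P1; HurwitzMicroSectors.DilationMove on the box, here
on the simplex, m = 2): for r, r′ on Δ_w with r.integrand t = r′.integrand(t_j²)_j · ∏ 2t_j, [r] −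
[r′] ∈ changeOfVariablesRel (coordinatewise squaring is an order-preserving bijection of Δ_w with
Jacobian ∏ 2t_j > 0); with d(t²)/(t² − b) = dt/(t−√b) + dt/(t+√b) it realises every level-2 →
level-4 distribution relation. [difficulty: provable-now] -/
@[route_item "route-KontsevichZagierPeriods-OctahedralSymmetry"]
def SimplexDilationMove : Prop :=
  ∀ (w : ℕ) (r r' : Literature.NumberTheory.Transcendental.KZ.IntegralRep w), r.domain = {t | (∀ i, 0 < t i) ∧ (∀ i, t i < 1) ∧ StrictAnti t} → r'.domain = {t | (∀ i, 0 < t i) ∧ (∀ i, t i < 1) ∧ StrictAnti t} → (∀ t ∈ r.domain, r.integrand t = r'.integrand (fun j => t j ^ 2) * ∏ j, (2 * t j)) → Literature.NumberTheory.Transcendental.KZ.of r - Literature.NumberTheory.Transcendental.KZ.of r' ∈ Literature.NumberTheory.Transcendental.KZ.changeOfVariablesRel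

-- `SimplexDilationMove` holds: proved by `Summit.KontsevichZagierPeriods.OctahedralSymmetry.SimplexDilationMove.simplexDilationMove_proof` @ eac1817e3e66 (its module imports this route file, so no `_holds` link can be stated here).

/-- item stmt-KontsevichZagierPeriods-9437 · support · rank 9 · closed · proved by Summit.KontsevichZagierPeriods.OctahedralSymmetry.quarterDiscFaceWeightTwo_proof @ d0fbaca65842 (prover) · by planner
sources: arXiv:0810.1064, arXiv:2201.01676, KontsevichZagier2001
[support] the smallest instance of the card's prism-Stokes compile (face {0,1,i} of the octahedron,
word (e₀, e_{−1}), imaginary part): [Δ₂, 1/(t₀(1+t₁²))] + [Δ₂, 2t₁/((1+t₀²)(1+t₁²))] − [(0,1)²,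
2/((1+t₀²)(1+t₁))] ∈ KZ.relations — values G (Catalan, = ∫₀¹ arctan t/t) + ((π/2)log 2 − G) −
(π/2)log 2, checked to 4e−15. Geometric proof: the segment [0,i] and the path [0,1]·arc(1→i) are
homotopic in ℂ∖{−1,−i} rel endpoints; Stokes on Δ₂ × [0,1] for the closed pulled-back 2-form has
zero bulk, null degenerate faces (dz∧dz = 0) and rational primitives (the components of the
pull-back), then deconcatenation = domain additivity + Fubini and the letter substitutions ρ^*ω_a =
ω_{c_a} − ω_{−i}. Calibrates every convention of the route on a 3-term identity. [difficulty: M] -/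
@[route_item "route-KontsevichZagierPeriods-OctahedralSymmetry"]
def QuarterDiscFaceWeightTwo : Prop :=
  ∀ (r₁ r₂ r₃ : Literature.NumberTheory.Transcendental.KZ.IntegralRep 2), r₁.domain = {t | 1 > t 0 ∧ t 0 > t 1 ∧ t 1 > 0} → Set.EqOn r₁.integrand (fun t => 1 / (t 0 * (1 + t 1 ^ 2))) r₁.domain → r₂.domain = {t | 1 > t 0 ∧ t 0 > t 1 ∧ t 1 > 0} → Set.EqOn r₂.integrand (fun t => 2 * t 1 / ((1 + t 0 ^ 2) * (1 + t 1 ^ 2))) r₂.domain → r₃.domain = {t | ∀ i, t i ∈ Set.Ioo (0:ℝ) 1} → Set.EqOn r₃.integrand (fun t => 2 / ((1 + t 0 ^ 2) * (1 + t 1))) r₃.domain → Literature.NumberTheory.Transcendental.KZ.of r₁ + Literature.NumberTheory.Transcendental.KZ.of r₂ - Literature.NumberTheory.Transcendental.KZ.of r₃ ∈ Literature.NumberTheory.Transcendental.KZ.relations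

-- `QuarterDiscFaceWeightTwo` holds: proved by `Summit.KontsevichZagierPeriods.OctahedralSymmetry.quarterDiscFaceWeightTwo_proof` @ d0fbaca65842 (its module imports this route file, so no `_holds` link can be stated here).

-- item stmt-KontsevichZagierPeriods-9660 · support · rank 9 · open · by planner — informal only, no Lean statement yet:
--   [support] PathHomotopyStokes (card K2, the reusable prism-Stokes ENGINE behind
--   QuarterDiscFaceWeightTwo and the e₁-free quarter-disc face family — an alternative generator to the
--   involution with the same computed ranks for w ≤ 4). For rational 1-forms ω₁,…,ω_w on ℂ with poles in
--   a finite S ⊂ ℚ(i) and two ℚ-semialgebraic piecewise-C¹ paths γ₀, γ₁ : [0,1] → ℂ with common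
--   endpoints p, q, joined by a ℚ-semialgebraic homotopy H : [0,1]² → ℂ with H((0,1)²) ∩ S = ∅
--   (endpoints may lie in S provided ω₁ is regular at q and ω_w at p, so that all iterated integrals
--   converge absolutely): the representation

-- item stmt-KontsevichZagierPeriods-9661 · support · rank 9 · open · by planner — informal only, no Lean statement yet:
--   [support] LevelNineWitness (card K4, corrected by this session's literature read; Neg-facing).
--   Levels 6, 8, 10, 12 are NOT sourceless: Au2022 §5.1 (arXiv:2201.01676) generates their non-standard
--   relations by chains of N-unital rational maps (change of variables by NON-invertible rational R with
--   R⁻¹{0,1,∞} ⊂ {0,∞}∪μ_N) plus path homotopy, reaching Deligne's bound for (N,w) = (6,≤5), (8,≤4),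
--   (10,≤3), (12,≤3). The genuinely sourceless instance is LEVEL 9, WEIGHT 3: SR(3,9) − D(3,9) = 3
--   non-standard relations are predicted (arXiv:0707.1459 Table 1, arXiv:0810.1064 Thm 3; D from
--   DeligneGoncharov200

-- earlier Assembly (stmt-KontsevichZagierPeriods-11043, replaced 2026-08-16T13:43:06Z -> stmt-KontsevichZagierPeriods-15034): proved by Summit.KontsevichZagierPeriods.OctahedralSymmetry.assembly_proof — ZhaoRelationInKZ → LevelFourStuffleInKZ → OctahedralInvolutionMove → LevelFourSectorKernel → KontsevichZagierPeriods
-- earlier Assembly (stmt-KontsevichZagierPeriods-9439, replaced 2026-08-15T16:37:51Z -> stmt-KontsevichZagierPeriods-11043): retired by None — ZhaoRelationInKZ → LevelFourStuffleInKZ → OctahedralInvolutionMove → LevelFourSectorToKernel → KernelImpliesStatement → KontsevichZagierPeriods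
/-- item stmt-KontsevichZagierPeriods-15034 · assembly · rank 1 · open · by planner
sources: KontsevichZagier2001, arXiv:0810.1064
[assembly] ZhaoRelationInKZ → LevelFourStuffleInKZ → OctahedralInvolutionMove → KernelForm →
KontsevichZagierPeriods (modus ponens through the declared complement KernelForm = shared item
stmt-KontsevichZagierPeriods-10447; literally the chain of the deciding theorem `closes`, rev 9 —
provable now by `closes`; Theorems/OctahedralSymmetryAssembly.lean's `unfold Assembly; exact closes`
proves it verbatim). Restated 2026-08-16 (route-choice) from the rev-5 form, which ran through the
dropped bespoke complement LevelFourSectorKernel (stmt-9845). [difficulty: provable-now] [sources: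
KontsevichZagier2001, arXiv:0810.1064] -/
@[route_item "route-KontsevichZagierPeriods-OctahedralSymmetry"]
def Assembly : Prop :=
  ZhaoRelationInKZ → LevelFourStuffleInKZ → OctahedralInvolutionMove → KernelForm → KontsevichZagierPeriods

/-! D-0027 §2.1 — DECIDING THEOREM (planner-authored via `route open/edit --closes-file`; by planner-rchoice-KontsevichZagierPeriods-Octahe-51f48a98-0 2026-08-16T13:43:06Z):
its hypotheses are this route's items and its conclusion the sub-problem Statement (glue_lint), and it elaborates with this file. -/

@[closes "route-KontsevichZagierPeriods-OctahedralSymmetry"] theorem closes : ZhaoRelationInKZ → LevelFourStuffleInKZ → OctahedralInvolutionMove → KernelForm → KontsevichZagierPeriods := by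
  intro _ _ _ hK n m r r' _ _ hv
  have h0 : Literature.NumberTheory.Transcendental.KZ.eval (Literature.NumberTheory.Transcendental.KZ.of r - Literature.NumberTheory.Transcendental.KZ.of r') = 0 := by
    simp [Literature.NumberTheory.Transcendental.KZ.eval_of, hv]
  exact hK _ h0

end Summit.KontsevichZagierPeriods.KontsevichZagierPeriods.Theses.OctahedralSymmetry
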